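import Literature.Analysis.FluidPDE.SelfSimilar
import Literature.Analysis.FluidPDE.LerayHopfMild
import HarnessLib

/-!
# Pairings of bounded ancient mild solutions with divergence-free tests are Lipschitz in time

Analysis/FluidPDE support file (all results proved) for the named fact
`Literature.Analysis.FluidPDE.knss_bound_C_over_r` (`SelfSimilarLiouville`; Koch–Nadirashvili–Seregin–Šverák 2009,
Theorem 5.3) and its companion `Literature.Analysis.FluidPDE.KNSSLiouville`: the first step of the
bridge from the tree's *duality-form* class of bounded ancient mild solutions
(`Fluid.IsBoundedAncientMildSolution`: the unforced two-time identity of Fabes–Jones–Rivière 1972,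
Thm. 2.1, `Fluid.IsMildNSSolutionBetween ν 0 u s t`, between all `s < t < 0`) to the `L^∞`
space–time weak solutions in which KNSS state their Liouville theorems (arXiv:0709.3599, §4
(ii)). KNSS themselves pass between the two settings through their regularity theory (§4, and
Lemma 6.1: bounded mild solutions converge locally uniformly); here we record the elementary
quantitative fact behind the time regularity of the duality class.

**Main results.** Let `E` be a finite-dimensional real inner product space, `0 < ν`, and `u` a
bounded ancient mild solution with `‖u(t, x)‖ ≤ M` for `t < 0` and measurable slices.

* `Fluid.integral_inner_heatTest_sub_eq_of_norm_le`, `Fluid.norm_integral_inner_heatTest_sub_le_of_norm_le`: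
  the **`L^∞`–`L¹` caloric pairing lemma** — for bounded measurable `w` and `φ ∈ C²_c`,
  `⟨w, e^{ν(t-σ₂)Δ}φ⟩ - ⟨w, e^{ν(t-σ₁)Δ}φ⟩ = ∫_{σ₁}^{σ₂} ⟨w, -ν e^{ν(t-σ)Δ}Δφ⟩ dσ`, hence
  `|…| ≤ (σ₂ - σ₁) ν M ‖Δφ‖₁` (the `L²` version is `Fluid.integral_inner_heatTest_sub_eq` of
  `LerayHopfMild`; Fabes–Jones–Rivière 1972, §2);
* `Fluid.norm_integral_inner_convect_heatTest_le`: the nonlinear duality term obeys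
  `|⟨v, (v·∇) e^{ντΔ}φ⟩| ≤ M² ‖Dφ‖₁` for every field `v` bounded by `M` (measurable or not: for a
  non-integrable integrand Mathlib's Bochner integral is `0`);
* `Fluid.IsBoundedAncientMildSolution.norm_integral_inner_sub_le`: for a smooth compactly
  supported divergence-free `φ` and `s ≤ t < 0`,
  `|⟨u(t), φ⟩ - ⟨u(s), φ⟩| ≤ (t - s) (ν M ‖Δφ‖₁ + M² ‖Dφ‖₁)`;
* `Fluid.IsBoundedAncientMildSolution.lipschitzOnWith_integral_inner`,
  `….continuousOn_integral_inner`: `t ↦ ⟨u(t), φ⟩` is Lipschitz, in particular continuous, on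
  `(-∞, 0)`.

## Proof and the junk-value point

By the two-time identity, `⟨u(t), φ⟩ - ⟨u(s), φ⟩ = (⟨u(s), e^{ν(t-s)Δ}φ⟩ - ⟨u(s), φ⟩) + J`,
where `J = ∫ₛᵗ ⟨u(τ), (u(τ)·∇) e^{ν(t-τ)Δ}φ⟩ dτ` is Mathlib's interval (Bochner) integral. The
first bracket is the caloric pairing increment, `O(t - s)` by the `L^∞`–`L¹` pairing lemma
(pointwise backward heat equation `heatTest_sub_eq_integral` integrated against `u(s)`, Fubini).
The integrand of `J` is bounded by `M² ‖D e^{ν(t-τ)Δ}φ‖₁ ≤ M² ‖Dφ‖₁` at *every* `τ ∈ (s, t]`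
(`D` commutes with the heat flow, which contracts `L¹`), so `|J| ≤ (t - s) M² ‖Dφ‖₁` by
`intervalIntegral.norm_integral_le_of_norm_le_const` — a bound that holds **whether or not the
integrand is integrable in `τ`**, i.e. also when the Bochner integral takes its junk value `0`.
This is why no joint measurability of `u` in `(t, x)` is needed, only measurability of the
slices (used to make the two pairings honest integrals).

## References

* G. Koch, N. Nadirashvili, G. Seregin, V. Šverák, *Liouville theorems for the Navier–Stokes
  equations and applications*, Acta Math. 203 (2009) 83–105 = arXiv:0709.3599, §4 (bounded mild
  and weak solutions), §6 Lemma 6.1. [KochNadirashviliSereginSverak2009]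
* E. B. Fabes, B. F. Jones, N. M. Rivière, *The initial value problem for the Navier–Stokes
  equations with data in `L^p`*, Arch. Rational Mech. Anal. 45 (1972) 222–240, §2, Thm. 2.1.
  [FabesJonesRiviere1972]
-/

noncomputable section

open MeasureTheory TopologicalSpace Set Function Filter Topology InnerProductSpace
open scoped RealInnerProductSpace ENNReal NNReal Laplacian ContDiff

namespace Literature.Analysis.FluidPDE

variable {E : Type*} [NormedAddCommGroup E] [InnerProductSpace ℝ E] [FiniteDimensional ℝ E]
  [MeasurableSpace E] [BorelSpace E]

/-! ### The `L^∞`–`L¹` caloric pairing lemma -/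

section Caloric

variable {F' : Type*} [NormedAddCommGroup F'] [InnerProductSpace ℝ F'] [CompleteSpace F']

/-- The time derivative of the caloric test field, `-ν e^{ν(t-σ)Δ}Δφ`, has `L¹` norm at most
`ν ‖Δφ‖₁`, for every `σ` (real-integral form; `L¹` contraction of the heat flow). [folklore] -/
theorem integral_norm_heatTestDeriv_le {φ : E → F'} (hφ : ContDiff ℝ 2 φ)
    (hc : HasCompactSupport φ) {ν : ℝ} (hν : 0 ≤ ν) (t σ : ℝ) :
    ∫ x, ‖-(ν • heatFlow (Δ φ) (ν * (t - σ)) x)‖ ≤ ν * ∫ x, ‖(Δ φ) x‖ := by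
  have hΔi : Integrable (Δ φ) :=
    (continuous_laplacian hφ).integrable_of_hasCompactSupport (hasCompactSupport_laplacian hc)
  have h1 : (fun x => ‖-(ν • heatFlow (Δ φ) (ν * (t - σ)) x)‖) =
      fun x => ν * ‖heatFlow (Δ φ) (ν * (t - σ)) x‖ := by
    ext x; rw [norm_neg, norm_smul, Real.norm_of_nonneg hν]
  rw [h1, integral_const_mul]
  exact mul_le_mul_of_nonneg_left (integral_norm_heatFlow_le hΔi _) hν

/-- The time derivative of the caloric test field is integrable, for every `σ`. [folklore] -/
theorem integrable_heatTestDeriv {φ : E → F'} (hφ : ContDiff ℝ 2 φ) (hc : HasCompactSupport φ)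
    (ν t σ : ℝ) : Integrable (fun x => -(ν • heatFlow (Δ φ) (ν * (t - σ)) x)) := by
  have hΔi : Integrable (Δ φ) :=
    (continuous_laplacian hφ).integrable_of_hasCompactSupport (hasCompactSupport_laplacian hc)
  exact ((integrable_heatFlow hΔi _).smul ν).neg

omit [CompleteSpace F'] in
/-- The pairing of a bounded measurable field with an integrable field is integrable. [folklore] -/
theorem integrable_inner_of_aestronglyMeasurable_of_norm_le {w g : E → F'} (hw : AEStronglyMeasurable w volume)
    {M : ℝ} (hM : ∀ x, ‖w x‖ ≤ M) (hg : Integrable g) :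
    Integrable (fun x => ⟪w x, g x⟫) := by
  refine Integrable.mono' (hg.norm.const_mul M) (hw.inner hg.aestronglyMeasurable)
    (Eventually.of_forall fun x => ?_)
  calc ‖⟪w x, g x⟫‖ ≤ ‖w x‖ * ‖g x‖ := norm_inner_le_norm _ _
    _ ≤ M * ‖g x‖ := mul_le_mul_of_nonneg_right (hM x) (norm_nonneg _)

/-- The pairing of a field bounded by `M` with `-ν e^{aΔ}Δφ` is at most `ν M ‖Δφ‖₁` in norm
(no measurability needed: a non-integrable integrand has integral `0`). [folklore] -/
theorem norm_integral_inner_heatTestDeriv_le {φ w : E → F'} {M : ℝ} (hM : ∀ x, ‖w x‖ ≤ M)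
    (hφ : ContDiff ℝ 2 φ) (hc : HasCompactSupport φ) {ν : ℝ} (hν : 0 ≤ ν) (t σ : ℝ) :
    ‖∫ x, ⟪w x, -(ν • heatFlow (Δ φ) (ν * (t - σ)) x)⟫‖ ≤ ν * (M * ∫ x, ‖(Δ φ) x‖) := by
  have hM0 : 0 ≤ M := (norm_nonneg _).trans (hM 0)
  have hDi := integrable_heatTestDeriv hφ hc ν t σ
  have h1 : ‖∫ x, ⟪w x, -(ν • heatFlow (Δ φ) (ν * (t - σ)) x)⟫‖ ≤
      ∫ x, M * ‖-(ν • heatFlow (Δ φ) (ν * (t - σ)) x)‖ := by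
    refine norm_integral_le_of_norm_le (hDi.norm.const_mul M) (Eventually.of_forall fun x => ?_)
    calc ‖⟪w x, -(ν • heatFlow (Δ φ) (ν * (t - σ)) x)⟫‖
        ≤ ‖w x‖ * ‖-(ν • heatFlow (Δ φ) (ν * (t - σ)) x)‖ := norm_inner_le_norm _ _
      _ ≤ M * ‖-(ν • heatFlow (Δ φ) (ν * (t - σ)) x)‖ :=
        mul_le_mul_of_nonneg_right (hM x) (norm_nonneg _)
  rw [integral_const_mul] at h1
  have h2 := mul_le_mul_of_nonneg_left (integral_norm_heatTestDeriv_le hφ hc hν t σ) hM0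
  have h3 : M * (ν * ∫ x, ‖(Δ φ) x‖) = ν * (M * ∫ x, ‖(Δ φ) x‖) := by ring
  exact h1.trans (h2.trans_eq h3)

/-- **The `L^∞`–`L¹` caloric pairing lemma.** For a bounded measurable field `w`, `φ ∈ C²_c`,
`0 < ν` and `σ₁ ≤ σ₂ ≤ t`,
`⟨w, e^{ν(t-σ₂)Δ}φ⟩ - ⟨w, e^{ν(t-σ₁)Δ}φ⟩ = ∫_{σ₁}^{σ₂} ⟨w, -ν e^{ν(t-σ)Δ}Δφ⟩ dσ`
(the pointwise identity `heatTest_sub_eq_integral` integrated against `w`, Fubini being justified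
by `∫∫ |w| |e^{ν(t-σ)Δ}Δφ| ≤ (σ₂ - σ₁) M ν ‖Δφ‖₁`; Fabes–Jones–Rivière 1972, §2, the duality
computation with the caloric test field, here for `w ∈ L^∞` instead of `L²`). [cite: FabesJonesRiviere1972, §2] -/
theorem integral_inner_heatTest_sub_eq_of_norm_le {φ w : E → F'}
    (hw : AEStronglyMeasurable w volume) {M : ℝ} (hM : ∀ x, ‖w x‖ ≤ M)
    (hφ : ContDiff ℝ 2 φ) (hc : HasCompactSupport φ) {ν t σ₁ σ₂ : ℝ} (hν : 0 < ν)
    (h12 : σ₁ ≤ σ₂) (h2t : σ₂ ≤ t) :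
    (∫ x, ⟪w x, heatTest ν φ (t - σ₂) x⟫) - ∫ x, ⟪w x, heatTest ν φ (t - σ₁) x⟫ =
      ∫ σ in σ₁..σ₂, ∫ x, ⟪w x, -(ν • heatFlow (Δ φ) (ν * (t - σ)) x)⟫ := by
  set D : ℝ → E → F' := fun σ x => -(ν • heatFlow (Δ φ) (ν * (t - σ)) x) with hD
  have hM0 : 0 ≤ M := (norm_nonneg _).trans (hM 0)
  have hφi : Integrable φ := hφ.continuous.integrable_of_hasCompactSupport hc
  have hψi : ∀ σ, Integrable (heatTest ν φ (t - σ)) := fun σ => integrable_heatFlow hφi _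
  have hi : ∀ σ, Integrable (fun x => ⟪w x, heatTest ν φ (t - σ) x⟫) volume := fun σ =>
    integrable_inner_of_aestronglyMeasurable_of_norm_le hw hM (hψi σ)
  -- pointwise identity
  have hpt : ∀ x, heatTest ν φ (t - σ₂) x - heatTest ν φ (t - σ₁) x =
      ∫ σ in Ioc σ₁ σ₂, D σ x := fun x => by
    rw [hD, ← intervalIntegral.integral_of_le h12]
    exact heatTest_sub_eq_integral hφ hc hν h12 h2t x
  -- the integrand on the product `E × (σ₁, σ₂]`
  have hDc : Continuous fun q : ℝ × E => D q.1 q.2 := continuous_heatTestDeriv hφ hc ν t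
  set μ : Measure ℝ := volume.restrict (Ioc σ₁ σ₂) with hμ
  haveI : IsFiniteMeasure μ := by rw [hμ]; infer_instance
  have hm : AEStronglyMeasurable (fun z : E × ℝ => ⟪w z.1, D z.2 z.1⟫) (volume.prod μ) := by
    refine AEStronglyMeasurable.inner (𝕜 := ℝ) hw.comp_fst ?_
    exact (hDc.comp (continuous_snd.prodMk continuous_fst)).aestronglyMeasurable
  -- `L^∞`–`L¹` bound on each time slice of the integrand
  have hbound : ∀ σ, ∫⁻ x, ‖⟪w x, D σ x⟫‖ₑ ≤
      ENNReal.ofReal (M * (ν * ∫ x, ‖(Δ φ) x‖)) := fun σ => by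
    have hDi := integrable_heatTestDeriv hφ hc ν t σ
    have h1 : ∫⁻ x, ‖⟪w x, D σ x⟫‖ₑ ≤ ∫⁻ x, ‖M * ‖D σ x‖‖ₑ := by
      refine lintegral_mono fun x => ?_
      rw [← ofReal_norm, ← ofReal_norm]
      refine ENNReal.ofReal_le_ofReal ?_
      rw [Real.norm_of_nonneg (mul_nonneg hM0 (norm_nonneg _))]
      calc ‖⟪w x, D σ x⟫‖ ≤ ‖w x‖ * ‖D σ x‖ := norm_inner_le_norm _ _
        _ ≤ M * ‖D σ x‖ := mul_le_mul_of_nonneg_right (hM x) (norm_nonneg _)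
    refine h1.trans ?_
    have h2 : ∫⁻ x, ‖M * ‖D σ x‖‖ₑ = ENNReal.ofReal (∫ x, M * ‖D σ x‖) := by
      rw [ofReal_integral_eq_lintegral_ofReal (hDi.norm.const_mul M)
        (Eventually.of_forall fun x => mul_nonneg hM0 (norm_nonneg _))]
      refine lintegral_congr fun x => ?_
      rw [← ofReal_norm, Real.norm_of_nonneg (mul_nonneg hM0 (norm_nonneg _))]
    rw [h2]
    refine ENNReal.ofReal_le_ofReal ?_
    rw [integral_const_mul]
    exact mul_le_mul_of_nonneg_left (integral_norm_heatTestDeriv_le hφ hc hν.le t σ) hM0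
  have hint : Integrable (fun z : E × ℝ => ⟪w z.1, D z.2 z.1⟫) (volume.prod μ) := by
    refine ⟨hm, ?_⟩
    unfold HasFiniteIntegral
    rw [lintegral_prod_symm _ hm.enorm]
    calc ∫⁻ σ, ∫⁻ x, ‖⟪w x, D σ x⟫‖ₑ ∂volume ∂μ
        ≤ ∫⁻ _σ, ENNReal.ofReal (M * (ν * ∫ x, ‖(Δ φ) x‖)) ∂μ :=
          lintegral_mono fun σ => hbound σ
      _ = ENNReal.ofReal (M * (ν * ∫ x, ‖(Δ φ) x‖)) * μ univ := by rw [lintegral_const]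
      _ < ⊤ := ENNReal.mul_lt_top ENNReal.ofReal_lt_top (measure_lt_top _ _)
  -- integrability in `σ` for every `x`
  have hDi : ∀ x, Integrable (fun σ => D σ x) μ := fun x =>
    ((hDc.comp (continuous_id.prodMk continuous_const)).integrableOn_Icc.mono_set
      Ioc_subset_Icc_self)
  calc (∫ x, ⟪w x, heatTest ν φ (t - σ₂) x⟫) - ∫ x, ⟪w x, heatTest ν φ (t - σ₁) x⟫
      = ∫ x, ⟪w x, heatTest ν φ (t - σ₂) x - heatTest ν φ (t - σ₁) x⟫ := by
        rw [← integral_sub (hi σ₂) (hi σ₁)]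
        congr 1; ext x; rw [inner_sub_right]
    _ = ∫ x, ∫ σ, ⟪w x, D σ x⟫ ∂μ := by
        congr 1; ext x
        rw [hpt x, ← integral_inner (hDi x) (w x)]
    _ = ∫ σ, (∫ x, ⟪w x, D σ x⟫) ∂μ := integral_integral_swap hint
    _ = ∫ σ in σ₁..σ₂, ∫ x, ⟪w x, D σ x⟫ := by
        rw [hμ, intervalIntegral.integral_of_le h12]

/-- **Bound for the `L^∞`–`L¹` caloric pairing increment**: for bounded measurable `w`
(`‖w‖ ≤ M`), `φ ∈ C²_c`, `0 < ν`, `σ₁ ≤ σ₂ ≤ t`,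
`|⟨w, e^{ν(t-σ₂)Δ}φ⟩ - ⟨w, e^{ν(t-σ₁)Δ}φ⟩| ≤ (σ₂ - σ₁) ν M ‖Δφ‖₁`. [folklore] -/
theorem norm_integral_inner_heatTest_sub_le_of_norm_le {φ w : E → F'}
    (hw : AEStronglyMeasurable w volume) {M : ℝ} (hM : ∀ x, ‖w x‖ ≤ M)
    (hφ : ContDiff ℝ 2 φ) (hc : HasCompactSupport φ) {ν t σ₁ σ₂ : ℝ} (hν : 0 < ν)
    (h12 : σ₁ ≤ σ₂) (h2t : σ₂ ≤ t) :
    ‖(∫ x, ⟪w x, heatTest ν φ (t - σ₂) x⟫) - ∫ x, ⟪w x, heatTest ν φ (t - σ₁) x⟫‖ ≤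
      (σ₂ - σ₁) * (ν * (M * ∫ x, ‖(Δ φ) x‖)) := by
  rw [integral_inner_heatTest_sub_eq_of_norm_le hw hM hφ hc hν h12 h2t]
  have h := intervalIntegral.norm_integral_le_of_norm_le_const (a := σ₁) (b := σ₂)
    (C := ν * (M * ∫ x, ‖(Δ φ) x‖))
    (f := fun σ => ∫ x, ⟪w x, -(ν • heatFlow (Δ φ) (ν * (t - σ)) x)⟫)
    (fun σ _ => norm_integral_inner_heatTestDeriv_le hM hφ hc hν.le t σ)
  rwa [abs_of_nonneg (sub_nonneg.2 h12), mul_comm] at h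

end Caloric

/-! ### The nonlinear duality term of a bounded field -/

section Nonlinear

/-- **Bound for the nonlinear duality term.** For a field `v : E → E` bounded by `M` (no
measurability needed) and a test field `φ`, `|∫ ⟪v, (v·∇) e^{ντΔ}φ⟫| ≤ M² ‖Dφ‖₁` for every `ν`
and `τ`: pointwise `|⟪v, Dψ[v]⟫| ≤ M² ‖Dψ‖`, the derivative falls on the data
(`fderiv_heatFlow`) and the heat flow contracts `L¹` (`integral_norm_heatFlow_le`); if the
integrand is not integrable the Bochner integral is `0`. [folklore] -/
theorem norm_integral_inner_convect_heatTest_le {v : E → E} {M : ℝ} (hM : ∀ x, ‖v x‖ ≤ M)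
    {φ : E → E} (hφ : FunctionSpaces.IsTestFunctionOn (⊤ : Opens E) φ) (ν τ : ℝ) :
    ‖∫ x, ⟪v x, convect v (heatTest ν φ τ) x⟫‖ ≤ M ^ 2 * ∫ x, ‖fderiv ℝ φ x‖ := by
  have hM0 : 0 ≤ M := (norm_nonneg _).trans (hM 0)
  have hφ1 : ContDiff ℝ 1 φ := hφ.contDiff.of_le (by exact_mod_cast le_top)
  have hDφi : Integrable (fderiv ℝ φ) :=
    (hφ1.continuous_fderiv one_ne_zero).integrable_of_hasCompactSupport (hφ.hasCompactSupport.fderiv ℝ)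
  -- the derivative of the caloric test field is the heat flow of the derivative
  have hD : ∀ x, fderiv ℝ (heatTest ν φ τ) x = heatFlow (fderiv ℝ φ) (ν * τ) x := fun x =>
    fderiv_heatFlow hφ1 hφ.hasCompactSupport _ x
  have hHi : Integrable (heatFlow (fderiv ℝ φ) (ν * τ)) := integrable_heatFlow hDφi _
  calc ‖∫ x, ⟪v x, convect v (heatTest ν φ τ) x⟫‖
      ≤ ∫ x, M ^ 2 * ‖heatFlow (fderiv ℝ φ) (ν * τ) x‖ := by
        refine norm_integral_le_of_norm_le (hHi.norm.const_mul _) (Eventually.of_forall fun x => ?_)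
        rw [convect, hD x]
        calc ‖⟪v x, heatFlow (fderiv ℝ φ) (ν * τ) x (v x)⟫‖
            ≤ ‖v x‖ * ‖heatFlow (fderiv ℝ φ) (ν * τ) x (v x)‖ := norm_inner_le_norm _ _
          _ ≤ ‖v x‖ * (‖heatFlow (fderiv ℝ φ) (ν * τ) x‖ * ‖v x‖) :=
            mul_le_mul_of_nonneg_left (ContinuousLinearMap.le_opNorm _ _) (norm_nonneg _)
          _ ≤ M * (‖heatFlow (fderiv ℝ φ) (ν * τ) x‖ * M) :=
            mul_le_mul (hM x) (mul_le_mul_of_nonneg_left (hM x) (norm_nonneg _))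
              (mul_nonneg (norm_nonneg _) (norm_nonneg _)) hM0
          _ = M ^ 2 * ‖heatFlow (fderiv ℝ φ) (ν * τ) x‖ := by ring
    _ = M ^ 2 * ∫ x, ‖heatFlow (fderiv ℝ φ) (ν * τ) x‖ := integral_const_mul _ _
    _ ≤ M ^ 2 * ∫ x, ‖fderiv ℝ φ x‖ :=
        mul_le_mul_of_nonneg_left (integral_norm_heatFlow_le hDφi _) (sq_nonneg M)

/-- **Junk-robust bound for the nonlinear time integral of the duality identity.** For a family
of fields `u τ` bounded by `M` at every `τ ∈ (s, t]` and a test field `φ`,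
`|∫ₛᵗ ∫ ⟪u τ, (u τ·∇) e^{ν(t-τ)Δ}φ⟫ dτ| ≤ (t - s) M² ‖Dφ‖₁`, valid whether or not the integrand
is integrable in `τ` (`intervalIntegral.norm_integral_le_of_norm_le_const`). [folklore] -/
theorem norm_intervalIntegral_inner_convect_heatTest_le {u : ℝ → E → E} {M : ℝ} {s t : ℝ}
    (hst : s ≤ t) (hM : ∀ τ ∈ Ioc s t, ∀ x, ‖u τ x‖ ≤ M) {φ : E → E}
    (hφ : FunctionSpaces.IsTestFunctionOn (⊤ : Opens E) φ) (ν : ℝ) :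
    ‖∫ τ in s..t, ∫ x, ⟪u τ x, convect (u τ) (heatTest ν φ (t - τ)) x⟫‖ ≤
      (t - s) * (M ^ 2 * ∫ x, ‖fderiv ℝ φ x‖) := by
  have h := intervalIntegral.norm_integral_le_of_norm_le_const (a := s) (b := t)
    (C := M ^ 2 * ∫ x, ‖fderiv ℝ φ x‖)
    (f := fun τ => ∫ x, ⟪u τ x, convect (u τ) (heatTest ν φ (t - τ)) x⟫) (fun τ hτ => ?_)
  · rwa [abs_of_nonneg (sub_nonneg.2 hst), mul_comm] at h
  · rw [uIoc_of_le hst] at hτ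
    exact norm_integral_inner_convect_heatTest_le (hM τ hτ) hφ ν (t - τ)

end Nonlinear

/-! ### Lipschitz continuity in time of the pairings of a bounded ancient mild solution -/

section Ancient

variable {ν : ℝ} {u : ℝ → E → E}

/-- **Pairings of a bounded ancient mild solution are Lipschitz in time.** Let `u` be a bounded
ancient mild solution of Navier–Stokes (`0 < ν`, duality form, `Fluid.IsBoundedAncientMildSolution`)
with `‖u(t, x)‖ ≤ M` for `t < 0` and measurable slices. For every smooth compactly supported
divergence-free `φ` and `s ≤ t < 0`,
`|⟨u(t), φ⟩ - ⟨u(s), φ⟩| ≤ (t - s) (ν M ‖Δφ‖₁ + M² ‖Dφ‖₁)`.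
Proof: the two-time identity gives `⟨u(t), φ⟩ - ⟨u(s), φ⟩ = (⟨u(s), e^{ν(t-s)Δ}φ⟩ - ⟨u(s), φ⟩)
+ ∫ₛᵗ ⟨u(τ), (u(τ)·∇)e^{ν(t-τ)Δ}φ⟩ dτ`; the bracket is a caloric pairing increment
(`norm_integral_inner_heatTest_sub_le_of_norm_le`), the time integral — integrable or junk — is
bounded by `norm_intervalIntegral_inner_convect_heatTest_le` (module docstring). KNSS 2009, §4:
the class of bounded mild solutions; Fabes–Jones–Rivière 1972, Thm. 2.1: the duality identity. [cite: KochNadirashviliSereginSverak2009, §4 (arXiv:0709.3599 p. 8)] -/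
theorem IsBoundedAncientMildSolution.norm_integral_inner_sub_le
    (hu : IsBoundedAncientMildSolution ν u) (hν : 0 < ν) {M : ℝ} (hM : ∀ t < 0, ∀ x, ‖u t x‖ ≤ M)
    (hmeas : ∀ t < 0, AEStronglyMeasurable (u t) volume) {φ : E → E}
    (hφ : FunctionSpaces.IsTestFunctionOn (⊤ : Opens E) φ) (hdiv : VectorCalculus.IsDivFree φ) {s t : ℝ} (hst : s ≤ t)
    (ht : t < 0) :
    ‖(∫ x, ⟪u t x, φ x⟫) - ∫ x, ⟪u s x, φ x⟫‖ ≤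
      (t - s) * (ν * (M * ∫ x, ‖(Δ φ) x‖) + M ^ 2 * ∫ x, ‖fderiv ℝ φ x‖) := by
  rcases hst.eq_or_lt with rfl | hlt
  · simp
  have hs : s < 0 := hlt.trans ht
  have hφ2 : ContDiff ℝ 2 φ := contDiff_infty.1 hφ.contDiff 2
  -- the two-time identity between `s` and `t` (zero force)
  have key := hu.1.2 s t hlt ht φ hφ hdiv
  have hzero : (∫ τ in s..t, ∫ x, ⟪(0 : ℝ → E → E) τ x, heatTest ν φ (t - τ) x⟫) = 0 := by
    simp
  rw [hzero, add_zero] at key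
  -- caloric increment: `⟨u s, e^{ν(t-s)Δ}φ⟩ - ⟨u s, φ⟩`
  have hcal := norm_integral_inner_heatTest_sub_le_of_norm_le (hmeas s hs) (hM s hs) hφ2
    hφ.hasCompactSupport (t := t) hν hst le_rfl
  rw [sub_self, heatTest_zero_right] at hcal
  -- nonlinear term
  have hnl := norm_intervalIntegral_inner_convect_heatTest_le (u := u) hst
    (fun τ hτ x => hM τ (lt_of_le_of_lt hτ.2 ht) x) hφ ν
  have hsplit : (∫ x, ⟪u t x, φ x⟫) - ∫ x, ⟪u s x, φ x⟫ =
      -((∫ x, ⟪u s x, φ x⟫) - ∫ x, ⟪u s x, heatTest ν φ (t - s) x⟫) +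
        ∫ τ in s..t, ∫ x, ⟪u τ x, convect (u τ) (heatTest ν φ (t - τ)) x⟫ := by
    rw [key]; ring
  rw [hsplit]
  refine (norm_add_le _ _).trans ?_
  rw [norm_neg]
  refine (add_le_add hcal hnl).trans_eq ?_
  ring

/-- The pairings `t ↦ ⟨u(t), φ⟩` of a bounded ancient mild solution (bound `M`, measurable
slices, `0 < ν`) with a smooth compactly supported divergence-free `φ` are Lipschitz on
`(-∞, 0)` with constant `ν M ‖Δφ‖₁ + M² ‖Dφ‖₁` (`norm_integral_inner_sub_le`). [cite: KochNadirashviliSereginSverak2009, §4 (arXiv:0709.3599 p. 8)] -/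
theorem IsBoundedAncientMildSolution.lipschitzOnWith_integral_inner
    (hu : IsBoundedAncientMildSolution ν u) (hν : 0 < ν) {M : ℝ} (hM : ∀ t < 0, ∀ x, ‖u t x‖ ≤ M)
    (hmeas : ∀ t < 0, AEStronglyMeasurable (u t) volume) {φ : E → E}
    (hφ : FunctionSpaces.IsTestFunctionOn (⊤ : Opens E) φ) (hdiv : VectorCalculus.IsDivFree φ) :
    LipschitzOnWith (Real.toNNReal (ν * (M * ∫ x, ‖(Δ φ) x‖) + M ^ 2 * ∫ x, ‖fderiv ℝ φ x‖))
      (fun t => ∫ x, ⟪u t x, φ x⟫) (Iio 0) := by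
  set K : ℝ := ν * (M * ∫ x, ‖(Δ φ) x‖) + M ^ 2 * ∫ x, ‖fderiv ℝ φ x‖ with hK
  have hM0 : 0 ≤ M := by
    have h := hM (-1) (by norm_num) 0
    exact (norm_nonneg _).trans h
  have hK0 : 0 ≤ K := by
    have h1 : 0 ≤ ∫ x, ‖(Δ φ) x‖ := integral_nonneg fun _ => norm_nonneg _
    have h2 : 0 ≤ ∫ x, ‖fderiv ℝ φ x‖ := integral_nonneg fun _ => norm_nonneg _
    positivity
  refine LipschitzOnWith.of_dist_le_mul fun a ha b hb => ?_
  rw [Real.coe_toNNReal _ hK0, dist_eq_norm, Real.dist_eq]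
  rcases le_total a b with hab | hba
  · rw [← norm_neg, neg_sub, abs_of_nonpos (sub_nonpos.2 hab), neg_sub]
    have h := hu.norm_integral_inner_sub_le hν hM hmeas hφ hdiv hab hb
    rwa [mul_comm] at h
  · rw [abs_of_nonneg (sub_nonneg.2 hba)]
    have h := hu.norm_integral_inner_sub_le hν hM hmeas hφ hdiv hba ha
    rwa [mul_comm] at h

/-- **Weak continuity in time of bounded ancient mild solutions**: the pairings
`t ↦ ⟨u(t), φ⟩` with smooth compactly supported divergence-free fields are continuous on
`(-∞, 0)` (bound and measurability of the slices as in `lipschitzOnWith_integral_inner`;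
KNSS 2009, §4 and Lemma 6.1: bounded mild solutions are in fact smooth). [cite: KochNadirashviliSereginSverak2009, §4 (arXiv:0709.3599 p. 8)] -/
theorem IsBoundedAncientMildSolution.continuousOn_integral_inner
    (hu : IsBoundedAncientMildSolution ν u) (hν : 0 < ν)
    (hmeas : ∀ t < 0, AEStronglyMeasurable (u t) volume) {φ : E → E}
    (hφ : FunctionSpaces.IsTestFunctionOn (⊤ : Opens E) φ) (hdiv : VectorCalculus.IsDivFree φ) :
    ContinuousOn (fun t => ∫ x, ⟪u t x, φ x⟫) (Iio 0) := by
  obtain ⟨M, hM⟩ := hu.2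
  exact (hu.lipschitzOnWith_integral_inner hν (fun t ht x => hM t ht x) hmeas hφ hdiv).continuousOn

end Ancient

end Literature.Analysis.FluidPDE
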